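import Summits.BirchSwinnertonDyer.BirchSwinnertonDyer.Theses.ByReductionTypeAtTwo
import Summits.BirchSwinnertonDyer.BirchSwinnertonDyer.Theorems.ByReductionTypeAtTwoSupersingularUniformFlatLine
import Summits.BirchSwinnertonDyer.BirchSwinnertonDyer.Theorems.ByReductionTypeAtTwoSupersingularFlatBlindEulerChar
import Summits.BirchSwinnertonDyer.BirchSwinnertonDyer.Theorems.ByReductionTypeAtTwoSupersingularFlatBlindNoCotorsion
import Summits.BirchSwinnertonDyer.BirchSwinnertonDyer.Theorems.ByReductionTypeAtTwoSupersingularFlatBlindControlOfLocal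
import Summits.BirchSwinnertonDyer.BirchSwinnertonDyer.Theorems.ByReductionTypeAtTwoSupersingularTwoAdicImageCriterion
import Summits.BirchSwinnertonDyer.BirchSwinnertonDyer.Theorems.AlignedTransportAtTwoMainConjectureOfRankZeroBSDAtTwoTwoFixedPointLambdaParity
import Summits.BirchSwinnertonDyer.BirchSwinnertonDyer.Theorems.LambdaTransportDoorAtTwoMatsunoClassSecondFixedPoint
import Summits.BirchSwinnertonDyer.Rank1Residual.F1Sign2.HondaSystemAtTwo
import Summits.BirchSwinnertonDyer.Rank1Residual.Supersingular.BlindControlTwo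
import Summits.BirchSwinnertonDyer.Rank1Residual.X1.MuLambdaAlgebra
import Summits.BirchSwinnertonDyer.Rank1Residual.X5.TwoAdicTargets
import Summits.BirchSwinnertonDyer.Rank1Residual.P2.EmptyCellsAtTwo
import Literature.NumberTheory.EllipticCurves.AnticyclotomicSignedSelmerFiniteIndex
import Literature.NumberTheory.EllipticCurves.IwasawaMuLambdaDefinitions
import Literature.NumberTheory.EllipticCurves.QuadraticTwist
import Literature.NumberTheory.EllipticCurves.Selmer
import Literature.NumberTheory.EllipticCurves.Rank1Residual.Predicates
import HarnessLib

/-!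
# Cell `bsd-f1-sign2`, seat `-imc` g34 — D-imc-87 «THE TWIST-POINT PINCH AT THE BLIND ZERO»
# (crux `ByReductionTypeAtTwo.SupersingularRankZeroAtTwo`, stmt-BirchSwinnertonDyer-19097; registered line
# `Lines/odd_blind_package.lean` v2.13 @04fc80b988a3bb5c, stubs 6–7 = the LOWER half; named residual R-imc-76)

HONEST FRAMING.  Sketch = two typed candidate `Prop`s (K87-C, K87-E; `def … : Prop`, NOTHING ASSERTED) over tree
declarations (+ v1.1: K87-R, the restriction brick) + KERNEL theorems (sorry-free; pure `Λ`-algebra, the tree's rank-`0` signed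
chain, and v1.1 `K87-R ⟹ K87-C` by the tree's second-fixed-point brick).  No stub of the
registered line is touched; -imc runs no registry verb; BSD is proved for no curve; PARTITION 52421 = 17880 + 27650 + 3440 +
3451 (tree 60cbd0490886c010) unchanged; beyond-print theorem: no.

THE OBSERVATION (MEMO-imc §10.120).  On the named residual **R-imc-76** of the line (`r_an(E) = 0`, good supersingular at
`2`, non-CM, EVEN blind sign `w(E)·χ₈(N) = +1`, `r₂ := r_an(E^{(2)}) = 2`; 117 classes for `N < 7813`) every blind VALUE
certificate is dead (`Sel_{2^∞}(E^{(2)})` is infinite; `L♭(ψ₂) = 0`), and §10.110 (4)(d) booked a DERIVED `2`-adic height law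
as the missing tool.  NONE IS NEEDED on the sub-habitat `λ(L♭_E) = 1`:
* ANALYTIC side (finite modular-symbol certificates, already tabulated): `μ(L♭) = 0` and `λ(L♭) = 1`.  Then `L♭ ≐ (T+2)·unit` —
  by the cell's own two-fixed-points lemma (D-imc-64 / att-p5, `AlignedTransportAtTwoTwoFixedPoints.three_le_lam_or_of_odd_lam`:
  `λ + ord₀ + ord₋₂` is even, so on R-imc-76 `λ♭` is ODD; -an §45: the blind zero is SIMPLE, 38/38).
* ALGEBRAIC side: `(T+2) ∣ ξ♭` — NOT from a value, from the OBSTRUCTION ITSELF: `corank Sel_{2^∞}(E^{(2)}/ℚ) ≥ 2` (two independent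
  points, or `2`-parity) leaves a corank `≥ 1` subgroup of classes TRIVIAL at `2` (the `2`-adic completion of `E^{(2)}(ℚ₂)` has
  `ℤ₂`-rank `1`); such classes restrict along `ℚ(√2) ⊂ ℚ_∞` into `Sel♭(E/ℚ_∞)` (the •-condition contains the zero class: witness
  `Q = 0` in `sharpFlatLocalKummerOverOfEmb`) and `γ` acts on them by `ψ₂(γ) = −1`, i.e. `T = −2`; so `X♭/(T+2)X♭` is infinite and
  `(T+2) ∣ char X♭` (typed K87-C below; research-free plumbing over the tree's Selmer vocabulary).
* PINCH (`Λ`-algebra, kernel §3): Kato♭ `ξ ∣ G` (`G` = the `Λ`-avatar of `ϖ·L♭`, the line's UPPER half, stubs 1–3 + tree), `μ(G) = 0`,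
  `λ(G) ≤ 1 ≤ λ(ξ)` ⟹ `(ξ) = (G)` (`X1.MuLambda.span_eq_span_iff_mu_le_and_lam_le`) — the FULL ♭ main conjecture for `E` — whence
  Miller's `BSD(E,2)` by the tree's rank-`0` readings at the TRIVIAL character ONLY (`SignedRankZero.missingLowerBoundAt_of_signed
  LowerDivisibility` + `…Upper…` + `Typed.bsdp_of_missingPPartAt`).  No `(P₋₂)`, no `(K₋₂)`, no regulator, no height.
CENSUS (BC5-style witness table, `r87/pinch87.tsv` — HOME `MEMO-imc-data/dimc87/`): of the 117 R-imc-76 classes, 47 carry certified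
`(μ♭, λ♭)` in SF2-ALL (5889e4b42f490b48): **`λ♭ = 1` on 41/47 (87 %)** (`a₂ = 0`: 13/16, `a₂ = 2`: 24/27, `a₂ = −2`: 4/4), `μ♭ = 0`
certified 47/47; the 6 others have `λ♭ ∈ {3, 7, 9}` (extra `ι`-pairs of zeros; residual R-imc-87, all six `2`-congruent to rank-0
good-ss curves of conductor `≤ 369` — the K82/GV-transport habitat).  The same pinch closes the EXCEPTIONAL bucket (`a₂ = 0`, even,
`r₂ = 0`: `L♭(ψ₂) = 0` is a TREE THEOREM there, `flatLaw_evalAt_neg_two_of_rootNumber`, so no ♭ value certificate exists either) on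
its `λ♭ = 1` rows (43/66 sampled) GIVEN the algebraic exceptional zero K87-E (= the divisibility shadow of K71-X, §10.110).

WHY THIS IS NOT ALREADY IN THE TREE / MEMO (search-before-claim, §10.120 (5)): the `λ_alg ≥ λ_an` pinch is Greenberg–Vatsal p. 4 and the
tree's `KatoHalfPinch` / `TowerLambdaPinch` (ORDINARY `2`, `λ_alg` from `dim X/(2,T^j)X`); the second fixed point `T = −2` is D-imc-64 /
att-p5 (ORDINARY route `AlignedTransportAtTwo`, analytic side only); K71-R2/K71-X (§10.110) are CORANK statements needing `Ш(E^{(2)})`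
finite and were booked as inputs to a height law.  New here: (i) the algebraic certificate is the twist's Selmer corank — available
exactly where the value certificate dies (obstruction as resource), with NO finiteness of `Ш(E^{(2)})`; (ii) on `λ♭ = 1` it is the
WHOLE lower half; (iii) the habitat fraction 41/47 measured.

References: [GreenbergVatsal2000] p. 4 (after Thm. (1.2)); [Sprung2012] Def. 7.9/7.11, Thm. 7.14; [Kobayashi2003] Thm. 1.2/1.3 (shape,
odd p); [Kato2004Asterisque] Thm. 12.5/17.4; [Miller2011LMS] Def. 1.1; [DokchitserDokchitser2010Annals] Thm. 1.4 (2-parity);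
[GreenbergLNM1716] pp. 67–68, 181; [Washington1997] §7.1, §13.2.
-/

noncomputable section

open scoped Classical MatrixGroups ModularForm NumberField
open NumberField IsDedekindDomain CongruenceSubgroup WeierstrassCurve PowerSeries
open Literature.NumberTheory.EllipticCurves Literature.NumberTheory.EllipticCurves.IwasawaDual
  Literature.NumberTheory.EllipticCurves.Sprung2012 Literature.NumberTheory.EllipticCurves.Sprung2017
  Literature.NumberTheory.EllipticCurves.ModularForms
  Literature.NumberTheory.EllipticCurves.Rank1Residual Literature.NumberTheory.EllipticCurves.Rank1Residual.Typed
  Literature.NumberTheory.EllipticCurves.Kobayashi2003 Literature.NumberTheory.GaloisRepresentations ZpExtension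
  Literature.NumberTheory.EllipticCurves.AcSigned
open Summit.BirchSwinnertonDyer.Rank1Residual Summit.BirchSwinnertonDyer.Rank1Residual.Supersingular
  Summit.BirchSwinnertonDyer.Rank1Residual.X5.O1 Summit.BirchSwinnertonDyer.Rank1Residual.X1.MuLambda
  Summit.BirchSwinnertonDyer.BirchSwinnertonDyer.Theorems
-- `mu` / `lam` / `pfree` / `red` below are the tree's `Rank1Residual.X1.MuLambda` invariants on `Λ = ℤ₂⟦T⟧` (the namespace of
-- `span_eq_span_iff_mu_le_and_lam_le` and of `AlignedTransportAtTwoTwoFixedPoints.lam_X_add_C_two`); the verbatim port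
-- `Literature.NumberTheory.EllipticCurves.MuLambda.{mu,lam}` agrees with them by `rfl` (`mu_eq_literature_mu` below).

set_option linter.dupNamespace false
set_option autoImplicit false

namespace Summit.BirchSwinnertonDyer.BirchSwinnertonDyer.Cruxes.SupersingularRankZeroAtTwo.D87

/-! ## §1 K87-C — THE BLIND ZERO FROM THE TWIST'S SELMER CORANK (typed candidate; research-free plumbing) -/

/-- **K87-C `BlindZeroOfTwistSelmerCorankAtTwo`** (candidate `Prop`, nothing asserted; status: PROVABLE — no conjecture
enters, only Selmer plumbing the tree already has in parts: twisted inflation–restriction along `ℚ(√2) ⊂ ℚ_∞`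
(`SignedTransportAtTwo.fixedPoints_kerSubgroup_eq_bot_of_goodSS`, `IwasawaTwistedCoinvariants*`, t42 GEN 37 bricks (D1)(D2)),
`0 ∈ E^•` (`sharpFlatLocalKummerOverOfEmb`, witness `Q = 0`), `toDual_T_smul`, and `(T+2) ∣ char` from an infinite
`X/(T+2)X` (`Module.charIdeal` = Bourbaki product, `lengthAt` additivity, `IwasawaAlgebraCharIdealProofs`)).
For `E` good supersingular at `2`, ANY chroma `•`, any cyclotomic pins and local data `(g, c)`, any finitely generated
torsion •-dual datum with `char X• = (ξ)`, and any `ℚ`-model `W₂` of `E^{(2)} = E ⊗ χ₈`: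
**`corank_{ℤ₂} Sel_{2^∞}(W₂/ℚ) ≥ 2 ⟹ (T + 2) ∣ ξ`.**
Mechanism: the kernel of `loc₂` on `Sel_{2^∞}(W₂/ℚ)` has corank `≥ 2 − 1 = 1` (`W₂(ℚ₂) ⊗̂ ℤ₂` has rank `1`); its restriction
to `ℚ_∞ ⊃ ℚ(√2)` (over which `W₂ ≅ E`) lies in `Sel•(E/ℚ_∞)` (strict at the place over `2` ⟹ •; Kummer elsewhere), is
`conj_γ`-anti-invariant (`ψ₂(γ) = −1`) with finite kernel; dually `X• ↠ ℤ₂` with `T ↦ −2`, so `ℓ_{(T+2)}(X•) ≥ 1`.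
No finiteness of `Ш(W₂)`, no Honda legality of `c`, no CM / rank / sign hypothesis is needed (they only shrink the claim).
Used toward the crux: with `2`-parity ([DokchitserDokchitser2010Annals]: `corank Sel_{2^∞}(W₂) ≡ r_an(W₂) (mod 2)`) or two
independent points it feeds the pinch `bsdp_two_of_flatBlindPinch` (§3) on R-imc-76.
WITNESS (habitat census, R-imc-76 ∩ SF2-ALL): 47/47 rows have `rank E^{(2)}(ℚ) = 2` by Cremona generators (conductor `64N ≤ 499 968`)
and a SIMPLE analytic blind zero (38/38 covered by -an §45, `b = 0 ≠ b′`); IMC♭ ⊗ ℚ then demands exactly `(T+2) ∥ ξ♭`.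
WHY IT MIGHT FAIL: only bookkeeping at `p = 2` — the identification `E^{(2)}[2^∞]|_{G_{ℚ_∞}} ≅ E[2^∞]` twists `conj_σ` by
`ψ₂(σ) = ±1` (harmless: `−s` is strict iff `s` is), and the tree's •-condition is imposed at all `conj_σ`-translates of the
one place of `ℚ_∞` over `2` (all equal).  CHEAPEST FALSIFIER: a curve in R-imc-76 with `λ♭ = 1` whose `ξ♭(−2)` is a unit would
contradict IMC♭ — not computable directly; the analytic proxy (simple zero of `L♭` at `ψ₂` on every `r₂ = 2` row) holds 38/38.
REMARKS (REF1 §484 R484b/c, adopted v1.2): `ℚ(√2) ⊂ ℚ_∞` holds for THE unique `ℤ₂`-extension of `ℚ`, so `κ.IsCyclotomic` is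
automatic here (kept as a harmless binder matching the line); and since the statement is for ANY chroma it also gives
`(T+2) ∣ ξ♯` on R-imc-76, matching the forced analytic `L♯(ψ₂) = 0` (`tsum_sharp_neg_two_eq_zero`) — nobody needs to re-derive it.
PRINT LOCATORS (REF2 add11 T1): the twist-point divisor at ORDINARY `2` is Greenberg, LNM 1716 §5, conductor `195`
(`P = (0, 7√2)`, `(T+2) ∣ f_E`, pinched by a BSD-assumed VALUE); the blind zero as the `p = 2`-specific locus is flagged ibid.
(«for `p = 2`, we would have another possibility: `a = −2`»).
[cite: Sprung2012, Def. 7.9/7.11 (p. 1503), Thm. 7.14] [cite: Greenberg1999LNM, §3 (restriction in the cyclotomic tower), §5 (conductor 195)]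
[cite: DokchitserDokchitser2010Annals, Thm. 1.4 (= Thm. 4.19; p = 2: Monsky 1996)] -/
def BlindZeroOfTwistSelmerCorankAtTwo : Prop :=
  ∀ (W : WeierstrassCurve ℚ) [W.IsElliptic] [W.IsGloballyMinimal], GoodSS W 2 →
  ∀ (κ : ZpExtension ℚ 2) (γ : Field.absoluteGaloisGroup ℚ),
    κ.IsCyclotomic → κ.IsTopGenerator γ → IsCyclotomicVariable 2 γ →
  ∀ (v : HeightOneSpectrum (𝓞 ℚ)), (2 : 𝓞 ℚ) ∈ v.asIdeal →
  ∀ (g : Field.absoluteGaloisGroup (v.adicCompletion ℚ)) (c : ℕ → localPoints W (v.adicCompletion ℚ)) (col : Chroma)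
    (D : SharpFlatSelmerDualData W κ γ (closureEmb (K := ℚ) (v.adicCompletion ℚ)) (W.frobeniusTrace 2) g c col)
    [Module.Finite (IwasawaAlgebra 2) D.X], Module.IsTorsion (IwasawaAlgebra 2) D.X →
  ∀ (ξ : IwasawaAlgebra 2), D.charIdeal = Ideal.span {ξ} →
  ∀ (W₂ : WeierstrassCurve ℚ) [W₂.IsElliptic],
    (∃ C : WeierstrassCurve.VariableChange ℚ, C • W.quadraticTwist 2 = W₂) →
    2 ≤ W₂.selmerCorank 2 →
    (PowerSeries.X + PowerSeries.C (2 : ℤ_[2]) : IwasawaAlgebra 2) ∣ ξ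

/-! ## §2 K87-E — THE EXCEPTIONAL ALGEBRAIC BLIND ZERO AT `a₂ = 0` ON THE EVEN LOCUS (typed candidate; beyond print) -/

/-- **K87-E `FlatExceptionalBlindZeroAtTwo`** (candidate `Prop`, nothing asserted; status: BEYOND PRINT — the divisibility
shadow of K71-X (§10.110), i.e. the ALGEBRAIC MIRROR of the tree theorem `flatLaw_evalAt_neg_two_of_rootNumber`
(`BlindPointFlatTwo`: `a₂ = 0`, `w(E)·χ₈(N) = +1` ⟹ `L♭(−2) = 0` for every Sprung pair)).
For `E` good supersingular at `2` with `a₂ = 0`, blind sign `w(E)·χ₈(N_E) = +1`, cyclotomic pins, a HONDA-LEGAL local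
system `c` (the line's clause, `F1Sign2.IsHondaSystemAtTwo`), and every finitely generated torsion ♭-dual datum with
`char X♭ = (ξ)`: **`(T + 2) ∣ ξ`.**
Mechanism (K71-W♭/K71-X): at `a₂ = 0` the ψ₂-component of the ♭ condition is the isotropic PARTNER `H¹_w` of the point line in
the hyperbolic plane `H¹(ℚ₂, V₂E^{(2)})`; when `corank Sel_{2^∞}(E^{(2)}) ≥ 2` this is K87-C (any `c`); when it is `0` (so
`rank E^{(2)} = 0`, `Ш(E^{(2)})[2^∞]` finite) the relaxed Selmer line `loc₂ Sel_rel = ⟨z_Kato⟩` EQUALS `H¹_w`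
(`exp* z ≠ 0 ⟺ L(E^{(2)},1) ≠ 0`, isotropy of global classes), an EXCEPTIONAL class of `Sel♭_∞[γ+1]`; `2`-parity
([DokchitserDokchitser2010Annals]) excludes odd coranks on the even locus.  Used toward the crux: feeds the pinch (§3) on the
`(even, a₂ = 0)` bucket of stub 7, where NO ♭ value certificate can exist.
WITNESS: -an §45 T4, `a₂ = 0 ⇒ ord_{ψ₂} L♭ = 1` on 410/410 `r₂ = 0` rows (+ 95/95 `r₂ = 2` rows); IMC♭ ⊗ ℚ demands `(T+2) ∣ ξ♭`
on all of them; sampled habitat `λ♭ = 1`: 43/66 (`r₂ = 0`) + 13/16 (`r₂ = 2`).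
WHY IT MIGHT FAIL: the position statement K71-W♭ («`ker Col♭_ψ₂ = H¹_w` at `a₂ = 0`») is in print for no `p` at a non-trivial
real character; for a NON-Honda `c` the ♭ condition is junk (hence the legality binder); if Sprung's ♭ at `a₂ = 0` descended to
an ANISOTROPIC line instead, `corank = r₂ ∸ 1 = 0` at `r₂ = 0` and the statement is false there (the analytic order law
410/410 says otherwise through IMC♭).  CHEAPEST FALSIFIER: one `a₂ = 0`, even, `r₂ = 0` curve with `#Sel♭_∞[γ+1] < ∞` computed
from a layer-1 Honda model (D-imc-60/61 atlas) — not yet run.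
[cite: Sprung2012, Def. 7.9/7.11, Open Problem 7.22] [cite: Kobayashi2003, Prop. 8.18 (shape, odd p)] [cite: Kato2004Asterisque, Thm. 12.5]
[cite: DokchitserDokchitser2010Annals, Thm. 1.4] -/
def FlatExceptionalBlindZeroAtTwo : Prop :=
  ∀ (W : WeierstrassCurve ℚ) [W.IsElliptic] [W.IsGloballyMinimal], GoodSS W 2 → W.frobeniusTrace 2 = 0 →
    W.rootNumber * ZMod.χ₈ (W.conductorNorm ℤ : ZMod 8) = 1 →
  ∀ (κ : ZpExtension ℚ 2) (γ : Field.absoluteGaloisGroup ℚ),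
    κ.IsCyclotomic → κ.IsTopGenerator γ → IsCyclotomicVariable 2 γ →
  ∀ (v : HeightOneSpectrum (𝓞 ℚ)), (2 : 𝓞 ℚ) ∈ v.asIdeal →
  ∀ (g : Field.absoluteGaloisGroup (v.adicCompletion ℚ)) (c : ℕ → localPoints W (v.adicCompletion ℚ)),
    κ.IsTopGenerator (resGalOfEmb (closureEmb (K := ℚ) (v.adicCompletion ℚ)) g) →
    (∃ cneg, F1Sign2.IsHondaSystemAtTwo κ (closureEmb (K := ℚ) (v.adicCompletion ℚ)) W
        (W.frobeniusTrace 2) g cneg c) →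
  ∀ (D : SharpFlatSelmerDualData W κ γ (closureEmb (K := ℚ) (v.adicCompletion ℚ)) (W.frobeniusTrace 2) g c .flat)
    [Module.Finite (IwasawaAlgebra 2) D.X], Module.IsTorsion (IwasawaAlgebra 2) D.X →
  ∀ (ξ : IwasawaAlgebra 2), D.charIdeal = Ideal.span {ξ} →
    (PowerSeries.X + PowerSeries.C (2 : ℤ_[2]) : IwasawaAlgebra 2) ∣ ξ

/-! ## §3 KERNEL (sorry-free): the `Λ`-pinch at the blind zero and Miller's `BSD(E,2)` from it -/

/-- `T + 2 ≠ 0` in `Λ = ℤ₂⟦T⟧` (its `λ` is `1`). [folklore] -/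
theorem X_add_C_two_ne_zero : (PowerSeries.X + PowerSeries.C (2 : ℤ_[2]) : IwasawaAlgebra 2) ≠ 0 := by
  intro h
  have h2 : PowerSeries.constantCoeff (PowerSeries.X + PowerSeries.C (2 : ℤ_[2]) : IwasawaAlgebra 2) = 2 := by simp
  rw [h, map_zero] at h2
  exact absurd h2 (by norm_num)

/-- The two `μ`/`λ` vocabularies of the tree agree definitionally (`Literature…MuLambda` is the verbatim port of
`Rank1Residual.X1.MuLambda`). [folklore] -/
theorem mu_eq_literature_mu (g : IwasawaAlgebra 2) :
    mu g = Literature.NumberTheory.EllipticCurves.MuLambda.mu g ∧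
      lam g = Literature.NumberTheory.EllipticCurves.MuLambda.lam g := ⟨rfl, rfl⟩

/-- **The blind zero forces `λ ≥ 1`**: `(T+2) ∣ ξ ≠ 0 ⟹ 1 ≤ λ(ξ)` (`λ(T+2) = 1`, `λ` is additive). [cite: Washington1997, §7.1] -/
theorem one_le_lam_of_X_add_C_two_dvd {ξ : IwasawaAlgebra 2} (hξ : ξ ≠ 0)
    (hZ : (PowerSeries.X + PowerSeries.C (2 : ℤ_[2]) : IwasawaAlgebra 2) ∣ ξ) : 1 ≤ lam ξ := by
  obtain ⟨q, hq⟩ := hZ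
  have hq0 : q ≠ 0 := by rintro rfl; exact hξ (by rw [hq, mul_zero])
  rw [hq]
  exact AlignedTransportAtTwoTwoFixedPoints.lam_X_add_C_two.symm.le.trans (lam_le_lam_mul X_add_C_two_ne_zero hq0)

/-- **THE PINCH (pure `Λ`-algebra).** If `ξ ∣ G` (Kato's half), `G ≠ 0`, `μ(G) = 0`, `λ(G) ≤ 1` (the analytic certificates)
and `(T+2) ∣ ξ` (the algebraic blind zero), then `(G) = (ξ)` — BOTH divisibilities, i.e. the ♭ main conjecture for this
datum — and `λ(ξ) = λ(G) = 1`.  (`X1.MuLambda.span_eq_span_iff_mu_le_and_lam_le`: given `G = ξ·h`, `(G) = (ξ) ↔ μ(G) ≤ μ(ξ) ∧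
λ(G) ≤ λ(ξ)`.) [cite: GreenbergVatsal2000, p. 4 (after Thm. (1.2))] [cite: Washington1997, §7.1] -/
theorem span_eq_span_of_blindPinch {ξ G : IwasawaAlgebra 2} (hup : ξ ∣ G) (hG : G ≠ 0) (hμ : mu G = 0)
    (hlam : lam G ≤ 1) (hZ : (PowerSeries.X + PowerSeries.C (2 : ℤ_[2]) : IwasawaAlgebra 2) ∣ ξ) :
    Ideal.span ({G} : Set (IwasawaAlgebra 2)) = Ideal.span {ξ} ∧ G ∣ ξ ∧ lam ξ = 1 ∧ lam G = 1 := by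
  obtain ⟨h, hh⟩ := hup
  have hξ : ξ ≠ 0 := by rintro rfl; exact hG (by rw [hh, zero_mul])
  have h1 : 1 ≤ lam ξ := one_le_lam_of_X_add_C_two_dvd hξ hZ
  have hspan : Ideal.span ({G} : Set (IwasawaAlgebra 2)) = Ideal.span {ξ} :=
    (span_eq_span_iff_mu_le_and_lam_le hξ hG hh).mpr ⟨hμ.le.trans (Nat.zero_le _), hlam.trans h1⟩
  have hdvd : G ∣ ξ := by
    have hmem : ξ ∈ Ideal.span ({G} : Set (IwasawaAlgebra 2)) := by
      rw [hspan]; exact Ideal.mem_span_singleton_self ξ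
    exact Ideal.mem_span_singleton.mp hmem
  have hh0 : h ≠ 0 := by rintro rfl; exact hG (by rw [hh, mul_zero])
  have hle : lam ξ ≤ lam G := by rw [hh]; exact lam_le_lam_mul hξ hh0
  exact ⟨hspan, hdvd, by omega, by omega⟩

/-- **KERNEL K87-P `bsdp_two_of_flatBlindPinch` — Miller's `BSD(E,2)` in analytic rank `0` from the Kato half, the two
analytic certificates `μ(L′) = 0`, `λ(L′) ≤ 1`, and the algebraic blind zero `(T+2) ∣ ξ` — NOTHING at `ψ₂` beyond that.**
For a signed datum `D = (ξ, L′, c)` at `(E,2)` with the tree's rank-`0` readings at the TRIVIAL character ((K)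
`EulerCharacteristic`, (P) `Interpolation`, `2 ∤ c`), `E[2]` irreducible, `L(E,1) ≠ 0`, GZK: `(L′) = (ξ)` by
`span_eq_span_of_blindPinch`, then `SignedRankZero.missingLowerBoundAt_of_signedLowerDivisibility` /
`missingUpperBoundAt_of_signedUpperDivisibility` / `Typed.missingPPartAt_of_lower_of_upper` / `Typed.bsdp_of_missingPPartAt`.
In the registered line this is the closer for stub 7 on {`corank Sel_{2^∞}(E^{(2)}) ≥ 2`, `λ♭ = 1`} (with `(T+2) ∣ ξ` from K87-C)
and on {`a₂ = 0`, even, `λ♭ = 1`} (from K87-E), wired exactly where `bsdp_two_of_genericOdd` wires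
`bsdp_two_of_oneDivisibility_of_oddBlindControl` (same `(ξ, L′ = ±ξh, cc)` datum, same `hK`, `hP0`, `hcodd`, `hdvd`).  Sorry-free.
BOOKKEEPING (REF1 §484 R484a, adopted v1.2): `hμ`/`hlam` are read on the datum's `L′ = ϖ·L♭`; `λ(L′) = λ♭` but
`μ(L′) = v₂(ϖ) + μ♭`, so the tabulated `μ♭ = 0` certificates (SF2-ALL, 47/47 on R-imc-76) discharge `hμ` only GIVEN `v₂(ϖ) = 0`
— the reach figures 41/47 · 43/66 carry that label until the period-unit column (data ask D-imc-87) lands; the line's existing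
VALUE closers read their unit-value certificates on the same `L′` and stand on the same footing.
[cite: GreenbergVatsal2000, p. 4] [cite: Miller2011LMS, Def. 1.1] [cite: RaySprung2025, §1.2 (p. 2343)] -/
theorem bsdp_two_of_flatBlindPinch (W : WeierstrassCurve ℚ) [W.IsElliptic] [W.IsGloballyMinimal]
    (hGZK : rank_eq_analyticRank_of_analyticRank_le_one) (hirr : W.HasIrreducibleModPGaloisRep 2)
    (hL : W.entireLFunction 1 ≠ 0) (D : SignedDatum W 2) (hc : ¬ 2 ∣ D.c) (hK : D.EulerCharacteristic)
    (hP : D.Interpolation) (hup : D.UpperDivisibility) (hμ : mu D.L = 0) (hlam : lam D.L ≤ 1)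
    (hZ : (PowerSeries.X + PowerSeries.C (2 : ℤ_[2]) : IwasawaAlgebra 2) ∣ D.xi) : BSDp W 2 := by
  -- `L′ ≠ 0`: otherwise (P) gives `c·t = 0`, `t = 0`, `L(E,1) = 0`
  have hL0 : D.L ≠ 0 := by
    intro h0
    obtain ⟨t, ht, hLt⟩ := hP
    rw [h0, map_zero] at hLt
    have hcne : D.c ≠ 0 := fun hc0 => hc (by rw [hc0]; exact dvd_zero 2)
    have hc0 : (D.c : ℚ_[2]) ≠ 0 := by exact_mod_cast hcne
    have htz : ((t : ℚ) : ℚ_[2]) = 0 := by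
      have h' : (D.c : ℚ_[2]) * ((t : ℚ) : ℚ_[2]) = 0 := by rw [← hLt]; push_cast; rfl
      exact (mul_eq_zero.mp h').resolve_left hc0
    have ht0 : t = 0 := by exact_mod_cast htz
    have hΩC : (W.realPeriodRat : ℂ) ≠ 0 := Complex.ofReal_ne_zero.mpr W.realPeriodRat_pos_holds.ne'
    apply hL
    have h1 := ht
    rw [ht0, div_eq_iff hΩC] at h1
    simpa using h1
  obtain ⟨hspan, hlowdvd, -, -⟩ := span_eq_span_of_blindPinch hup hL0 hμ hlam hZ
  have hlow : MissingLowerBoundAt W 2 :=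
    missingLowerBoundAt_of_signedLowerDivisibility W 2 hGZK hirr hL D hc hK hP hlowdvd
  have hupp : MissingUpperBoundAt W 2 :=
    missingUpperBoundAt_of_signedUpperDivisibility W 2 hGZK hirr hL D hc hK hP hup
  have hr : W.analyticRank = 0 := analyticRank_eq_zero_of_entireLFunction_one_ne_zero W hL
  exact bsdp_of_missingPPartAt W 2 hGZK (by omega) (missingPPartAt_of_lower_of_upper W 2 hlow hupp)

/-- **Certificate form of the analytic input** — `μ(G) = 0` from `2 ∤ G` in `Λ` (the table's `μ♭ = 0` certificate and the
line's `FineMuZeroOnHabitatAtTwo` both read `¬ C 2 ∣ ·`). [cite: GreenbergVatsal2000, p. 2, (2)] -/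
theorem mu_eq_zero_of_not_C_two_dvd {G : IwasawaAlgebra 2}
    (h2 : ¬ (PowerSeries.C (2 : ℤ_[2]) : IwasawaAlgebra 2) ∣ G) : mu G = 0 := by
  have hred : red G ≠ 0 := by
    rw [Ne, red_eq_zero_iff]; exact_mod_cast h2
  exact (mu_eq_and_pfree_eq (a := 0) hred (by simp)).1

/-! ## §4 What the line would do with it (docstring only; -imc cuts nothing — director (830), v2.14 after G1b + G2–G4)

STUB 7 `LowerBoundOffGenericOddAtTwo` (even half + deep-odd), v2.15 CANDIDATE reading — three closers + one residual:
(7a) `a₂ = ±2`, `r_an(E^{(2)}) = 0`: the tree's blind VALUE certificate (`BlindControlTwo`, `ord_{ψ₂} L♭ = 0`, 471/471) — unchanged;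
(7b) `corank Sel_{2^∞}(E^{(2)}) ≥ 2` (⟸ `r_an(E^{(2)}) ≥ 2` & two points, or `2`-parity + `corank ≠ 0`) ∧ `μ♭ = 0` ∧ `λ♭ = 1`:
     `bsdp_two_of_flatBlindPinch` ∘ K87-C — NO new beyond-print statement (K87-C is plumbing); habitat 41/47 of sampled R-imc-76;
(7c) `a₂ = 0`, even, `μ♭ = 0`, `λ♭ = 1`: `bsdp_two_of_flatBlindPinch` ∘ K87-E (beyond print = K71-W♭ position); habitat 43/66 + 13/16;
(7d) RESIDUAL R-imc-87 = {`λ♭ ≥ 3`} ∪ {`r_an(E^{(2)}) ≥ 2`, `corank = 0`} ∪ deep-odd: 6/47 of sampled R-imc-76 (`λ♭ ∈ {3,7,9}`), 23/66 of the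
     exceptional bucket; tools: GV/Kim-type congruence TRANSPORT of IMC♭ at `2` (K82/§10.116; all six residual R-imc-76 classes are
     `2`-congruent to rank-0 good-ss curves of conductor `≤ 369`), or the §10.110 (4)(d) height law.
-/


/-! ## §5 (v1.1) K87-R — THE RESTRICTION BRICK, and K87-C FROM IT by the tree's second-fixed-point algebra

IN-TREE PRIOR ART (found after v1.0, recorded for honesty): cell `bsd-rank2`, seat p2 GEN 65,
`Theorems.LambdaTransportDoorAtTwoMatsunoClassSecondFixedPoint` — §1 the pure-`Λ` brick
`lambdaInvariant_quotient_X_add_two_eq_zero_iff_not_dvd : rank_{ℤ₂} X/(T+2)X = 0 ⟺ (T+2) ∤ f_X` (any f.g. torsion `Λ`-module with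
`char X = (f_X)`), §2 the ORDINARY twin on Matsuno's class `𝒞(15A8)`: `ord_{T=−2} L₂(A,T) = corank Sel_{2^∞}(A^{(2)}/ℚ) =
rank X₂(A/ℚ_∞)/(T+2)` with DISPLAYED Greenberg control `h12` at `ℚ(√2)` and `2`-parity `hpar2`.  So K87-C splits as
(restriction brick K87-R, below: the only new content, and the only place where «supersingular ♭» enters — through `strict ⊂ ♭`,
NO control theorem needed because only the inequality is claimed) ∘ (the tree's §1 brick), and the kernel theorem
`blindZeroOfTwistSelmerCorank_of_restriction` does the composition. -/

/-- **K87-R `TwistSelmerCorankLeFlatQuotientRankAtTwo`** (candidate `Prop`, nothing asserted; status: PROVABLE PLUMBING).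
For `E/ℚ` good supersingular at `2`, cyclotomic pins, ANY local datum `(v ∣ 2, g, c, col)` and every finitely generated torsion
•-dual datum `X• = D.X`: for every model `W₂` of `E^{(2)}`,
**`corank_{ℤ₂} Sel_{2^∞}(W₂/ℚ) ≤ rank_{ℤ₂} X•/(T+2)X• + 1`.**
Mechanism: `Sel_{2^∞}(E^{(2)}/ℚ) = Sel_{2^∞}(E/ℚ(√2))^{ψ₂ = −1}` (`ℚ(√2) = ℚ₁ ⊂ ℚ_∞`, `p = 2` only); the classes trivial at the
unique prime over `2` form a subgroup of corank `≥ corank − 1` (`E^{(2)}(ℚ₂) ⊗ ℚ₂/ℤ₂` has corank `1`); they restrict (finite kernel,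
`E(ℚ_∞)[2] = 0` by `GoodSS`) into `Sel•(E/ℚ_∞)[γ + 1]` because the •-condition contains the zero class (witness `Q = 0`), and
`(Sel•_∞[γ+1])^∨ = X•/(T+2)X•` (`toDual_T_smul`).  WHY IT MIGHT FAIL: bookkeeping only (the `ψ₂`-twist of `conj_σ`; all primes of
`ℚ_∞` over `2` coincide).  Bricks: t42 GEN 37 (D1)(D2) twisted restriction, `SignedTransportAtTwo.fixedPoints_kerSubgroup_eq_bot_of_goodSS`.
[cite: Greenberg1999LNM, §3 and Thm. 1.2 (shape of the restriction/control set-up)] [cite: Sprung2012, Def. 7.9/7.11] -/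
def TwistSelmerCorankLeFlatQuotientRankAtTwo : Prop :=
  ∀ (W : WeierstrassCurve ℚ) [W.IsElliptic] [W.IsGloballyMinimal], GoodSS W 2 →
  ∀ (κ : ZpExtension ℚ 2) (γ : Field.absoluteGaloisGroup ℚ),
    κ.IsCyclotomic → κ.IsTopGenerator γ → IsCyclotomicVariable 2 γ →
  ∀ (v : HeightOneSpectrum (𝓞 ℚ)), (2 : 𝓞 ℚ) ∈ v.asIdeal →
  ∀ (g : Field.absoluteGaloisGroup (v.adicCompletion ℚ)) (c : ℕ → localPoints W (v.adicCompletion ℚ)) (col : Chroma)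
    (D : SharpFlatSelmerDualData W κ γ (closureEmb (K := ℚ) (v.adicCompletion ℚ)) (W.frobeniusTrace 2) g c col)
    [Module.Finite (IwasawaAlgebra 2) D.X], Module.IsTorsion (IwasawaAlgebra 2) D.X →
  ∀ (W₂ : WeierstrassCurve ℚ) [W₂.IsElliptic],
    (∃ C : WeierstrassCurve.VariableChange ℚ, C • W.quadraticTwist 2 = W₂) →
    W₂.selmerCorank 2 ≤
      lambdaInvariant 2 (D.X ⧸ (Ideal.span {(PowerSeries.X + PowerSeries.C (2 : ℤ_[2]) : IwasawaAlgebra 2)} •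
        (⊤ : Submodule (IwasawaAlgebra 2) D.X))) + 1

/-- **KERNEL (v1.1): K87-R ⟹ K87-C**, by the tree's §1 brick `rank X/(T+2)X = 0 ⟺ (T+2) ∤ f_X`
(`LambdaTransportDoorAtTwoMatsunoClassSecondFixedPoint.lambdaInvariant_quotient_X_add_two_eq_zero_iff_not_dvd`):
`2 ≤ corank ≤ rank X♭/(T+2) + 1` forces `rank X♭/(T+2) ≠ 0`, hence `(T+2) ∣ ξ`. -/
theorem blindZeroOfTwistSelmerCorank_of_restriction (hR : TwistSelmerCorankLeFlatQuotientRankAtTwo) :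
    BlindZeroOfTwistSelmerCorankAtTwo := by
  intro W _ _ hss κ γ hκ hγ hγ' v hv g c col D _ hX ξ hξ W₂ _ hW₂ h2
  have hle := hR W hss κ γ hκ hγ hγ' v hv g c col D hX W₂ hW₂
  by_contra hndvd
  have h0 := (Summit.BirchSwinnertonDyer.BirchSwinnertonDyer.Theorems.LambdaTransportDoorAtTwoMatsunoClassSecondFixedPoint.lambdaInvariant_quotient_X_add_two_eq_zero_iff_not_dvd
    (M := D.X) hX (f := ξ) hξ).mpr hndvd
  omega

end Summit.BirchSwinnertonDyer.BirchSwinnertonDyer.Cruxes.SupersingularRankZeroAtTwo.D87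

end
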